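import Summits.AtomisticToContinuum.FouriersLaw.Theorems.BondHeatUncertaintyExtensiveSnapshotIrreversibilityEnergyWindowSkeletonSecondVariationMoments

/-!
# Energy window, part W-4 — the mixed (starting point, skeleton) second variation of the flow

Lineage `stmt-AtomisticToContinuum-9121` (`ExtensiveSnapshotIrreversibility`), K_fix half, leaf S3
`KernelTemperatureLipschitz`; (G1ℓ) ⟸ (SWM)_d ∧ (JM)✓ ∧ (JMˣ)₁✓ ∧ (JMˣ)₂✓ [+ (I-s2)ₛ; V-glue]
(critic rows 1107, 1128 (d)).  Cell decomp-a2c, lens «grading / quantitative ladder», generation 81,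
part W «Skeleton glue»: W-0 `…SkeletonSurjectivity` · W-1 `…SkeletonFieldCalculus` · W-2
`…SkeletonArrivalIntegrability` · W-3 `…ArrivalGlue` · W-4 (this file; imports the TREE part V-c
`…SkeletonSecondVariationMoments`, hence V-a, V-b1, V-b2, T-a1, T-a2).

WHY.  The departure identity (T-b3 `integral_mul_skelWeightDep_eq`) integrates by parts against the
field `u^{dep} = ((Γ+κ)⁻¹ e(x)) J(x)` whose direction
`e(x) = coordV (D_z X_s^{m}(z, r, x)[(0, e_b)])` (`skelDepVec`) DEPENDS ON THE SKELETON; its `hGdu` hypothesis therefore needs moments of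
`∂_{x_j} e(x) = coordV (D_x D_z X_s^{m}[(0,e_b)][b_j])` — the MIXED second variation of the flow in
(starting point, skeleton).  This file proves, with NO new hypothesis:
* §1 the joint solution-curve family `(z, x) ↦ X^{m}(z, r, x)` over the PAIR (starting point,
  skeleton) as a forced family of `ForcedSmoothDependence` (`skelJointCurve`, its affine forcing
  `skelJointForcing` with constant derivative `skelJointForcingDeriv`, `D²g = 0`), `C^∞` by R's
  `contDiff_pinnedChainSolCurve_uncurry`;
* §2 the dictionary: `D_x X`, `D_z X` and `D_x D_z X` at time `s` are evaluations of `D S'[(0,δ)]`,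
  `D S'[(v,0)]`, `D² S'[(0,δ)][(v,0)]` (V-a `fderiv_fderiv_eval_apply`);
* §3 the pathwise Grönwall bound for the starting-point variation at EVERY remainder/skeleton,
  `‖D_z X_u^{m}(z,r,x)[v]‖ ≤ ‖v‖ exp ∫₀ᵘ (A₀ + A₁√H)` (first-variation equation of the joint family,
  `fderiv_forcedSolution_family_apply`, + S′a's Grönwall);
* §4 **`norm_fderiv_fderiv_skelFlowMapAt_mixed_le`**: `‖D_x(D_z X_s^{m}[v])(x)[δ]‖ ≤
  max(|c_L|,|c_R|) ‖v‖ · skelAbsSum δ · exp ∫₀ˢ (3A₀ + (3A₁ + B₁)√H(X_u))` — V-b2's argument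
  (second-variation equation V-a + V-b1's `D² drift` bound + T-a1's Grönwall with forcing) with one
  skeleton direction replaced by a starting-point direction;
* §5 moments along the Brownian path (T-a2's engine, as V-c) and the window form
  **`skeletonMixedVariationMoments`** (quantifier shape of (JMˣ)₂, constant
  `C = √(4γT) · exp(3A₀ + q(3A₁+B₁)²/(4θ) + 4θγT)`, `θ = min ε (1/(4T))`).
No typeclass declarations, no new syntax, no options; no proof holes.
[cite: CuneoEckmannHairerReyBellet2018, §3 eq. (3.4)] [folklore]

**File 1 of 2** (split for the 400-line cap): this file holds §§1–3 (joint solution-curve family, the dictionary, the starting-point variation); the sequel module `…BondHeatUncertaintyExtensiveSnapshotIrreversibilityEnergyWindowSkeletonMixedVariation` continues in the same namespace (all declaration names unchanged).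
-/

noncomputable section

namespace Summit.AtomisticToContinuum.FouriersLaw.Theorems.ExtensiveSnapshotIrreversibility.EnergyWindow

open MeasureTheory Filter Topology unitInterval Set
open scoped ENNReal NNReal ContDiff Real
open Literature.MathematicalPhysics.KineticTheory.HeatConduction
open Literature.Probability.Process Literature.Analysis.ODE

/-! ## 1. The joint solution-curve family over (starting point, skeleton) -/

section JointDefs

variable (ω₂ lam β γ : ℝ) (N : ℕ) (T_L T_R : ℝ)

/-- The forcing family `(z, x) ↦ (τ ↦ z + (0, η₀^{r}(τ) + (H_m x)(τ)))` of the skeleton flow with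
remainder `r`, over the PAIR (starting point, skeleton). [folklore] -/
def skelJointForcing (m : ℕ) (r : WienerPair) (p : PhaseSpace N × PairSkeleton m) :
    C(I, PhaseSpace N) :=
  forcingCurve p.1 (continuous_chainNoise_rem ω₂ lam β γ N T_L T_R r)
    (skelForcing N m (ampL ω₂ lam β γ T_L) (ampR ω₂ lam β γ T_R)) p.2

/-- The (constant) derivative of the affine forcing family: `(v, δ) ↦ const v + lift (H_m δ)`.
[folklore] -/
def skelJointForcingDeriv (m : ℕ) : (PhaseSpace N × PairSkeleton m) →L[ℝ] C(I, PhaseSpace N) :=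
  (constCurve N).comp (ContinuousLinearMap.fst ℝ (PhaseSpace N) (PairSkeleton m)) +
    ((momentumLift N).comp (skelForcing N m (ampL ω₂ lam β γ T_L) (ampR ω₂ lam β γ T_R))).comp
      (ContinuousLinearMap.snd ℝ (PhaseSpace N) (PairSkeleton m))

/-- The forcing family is `derivative + base curve`. [folklore] -/
theorem skelJointForcing_eq (m : ℕ) (r : WienerPair) (p : PhaseSpace N × PairSkeleton m) :
    skelJointForcing ω₂ lam β γ N T_L T_R m r p =
      skelJointForcingDeriv ω₂ lam β γ N T_L T_R m p +
        baseForcingCurve 0 (continuous_chainNoise_rem ω₂ lam β γ N T_L T_R r) := by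
  unfold skelJointForcing
  rw [forcingCurve_eq_constCurve_add]
  show constCurve N p.1 + (baseForcingCurve 0 (continuous_chainNoise_rem ω₂ lam β γ N T_L T_R r) +
      momentumLift N (skelForcing N m (ampL ω₂ lam β γ T_L) (ampR ω₂ lam β γ T_R) p.2)) =
    constCurve N p.1 +
        momentumLift N (skelForcing N m (ampL ω₂ lam β γ T_L) (ampR ω₂ lam β γ T_R) p.2) +
      baseForcingCurve 0 (continuous_chainNoise_rem ω₂ lam β γ N T_L T_R r)
  abel

/-- The forcing family is differentiable with the constant derivative. [folklore] -/
theorem hasFDerivAt_skelJointForcing (m : ℕ) (r : WienerPair) (p : PhaseSpace N × PairSkeleton m) :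
    HasFDerivAt (skelJointForcing ω₂ lam β γ N T_L T_R m r)
      (skelJointForcingDeriv ω₂ lam β γ N T_L T_R m) p := by
  have hfun : skelJointForcing ω₂ lam β γ N T_L T_R m r = fun p =>
      skelJointForcingDeriv ω₂ lam β γ N T_L T_R m p +
        baseForcingCurve 0 (continuous_chainNoise_rem ω₂ lam β γ N T_L T_R r) :=
    funext fun p => skelJointForcing_eq ω₂ lam β γ N T_L T_R m r p
  rw [hfun]
  exact (skelJointForcingDeriv ω₂ lam β γ N T_L T_R m).hasFDerivAt.add_const _

/-- `D g' ≡ skelJointForcingDeriv`. [folklore] -/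
theorem fderiv_skelJointForcing (m : ℕ) (r : WienerPair) :
    fderiv ℝ (skelJointForcing ω₂ lam β γ N T_L T_R m r) =
      fun _ => skelJointForcingDeriv ω₂ lam β γ N T_L T_R m :=
  funext fun p => (hasFDerivAt_skelJointForcing ω₂ lam β γ N T_L T_R m r p).fderiv

/-- `D² g' = 0` (the forcing family is affine). [folklore] -/
theorem fderiv_fderiv_skelJointForcing (m : ℕ) (r : WienerPair)
    (p : PhaseSpace N × PairSkeleton m) :
    fderiv ℝ (fderiv ℝ (skelJointForcing ω₂ lam β γ N T_L T_R m r)) p = 0 := by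
  rw [fderiv_skelJointForcing, fderiv_const_apply]

/-- The forcing family is `C^n` for every `n`. [folklore] -/
theorem contDiff_skelJointForcing (m : ℕ) (r : WienerPair) {n : WithTop ℕ∞} :
    ContDiff ℝ n (skelJointForcing ω₂ lam β γ N T_L T_R m r) := by
  have hfun : skelJointForcing ω₂ lam β γ N T_L T_R m r = fun p =>
      skelJointForcingDeriv ω₂ lam β γ N T_L T_R m p +
        baseForcingCurve 0 (continuous_chainNoise_rem ω₂ lam β γ N T_L T_R r) :=
    funext fun p => skelJointForcing_eq ω₂ lam β γ N T_L T_R m r p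
  rw [hfun]
  exact (skelJointForcingDeriv ω₂ lam β γ N T_L T_R m).contDiff.add contDiff_const

/-- In the direction `(v, 0)` the derivative of the forcing family is the constant curve `v`.
[folklore] -/
theorem skelJointForcingDeriv_inl_apply (m : ℕ) (v : PhaseSpace N) (τ : I) :
    skelJointForcingDeriv ω₂ lam β γ N T_L T_R m (v, (0 : PairSkeleton m)) τ = v := by
  show (constCurve N v +
      momentumLift N (skelForcing N m (ampL ω₂ lam β γ T_L) (ampR ω₂ lam β γ T_R)
        (0 : PairSkeleton m))) τ = v
  rw [map_zero, map_zero, add_zero, constCurve_apply]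

end JointDefs

section Joint

variable {ω₂ lam β γ : ℝ} (hω : 0 < ω₂) (hl : 0 ≤ lam) (hβ : 0 ≤ β) (hγ : 0 ≤ γ) (N : ℕ)
  (T_L T_R : ℝ)

/-- **The joint solution-curve family** `(z, x) ↦ X^{m}_·(z, r, x) ∈ C([0,1], PhaseSpace N)` of the
skeleton flow with remainder `r`. [folklore] -/
def skelJointCurve (m : ℕ) (r : WienerPair) (p : PhaseSpace N × PairSkeleton m) :
    C(I, PhaseSpace N) :=
  pinnedChainSolCurve hω hl hβ hγ N p.1 (continuous_chainNoise_rem ω₂ lam β γ N T_L T_R r)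
    (skelForcing N m (ampL ω₂ lam β γ T_L) (ampR ω₂ lam β γ T_R)) p.2

/-- The time-`s` skeleton flow is the evaluation of the joint family. [folklore] -/
theorem skelFlowMapAt_eq_skelJointCurve {s : ℝ} (hs : s ∈ Icc (0 : ℝ) 1) (m : ℕ)
    (z : PhaseSpace N) (r : WienerPair) (x : PairSkeleton m) :
    skelFlowMapAt ω₂ lam β γ N T_L T_R s m z r x =
      skelJointCurve hω hl hβ hγ N T_L T_R m r (z, x) ⟨s, hs⟩ := rfl

/-- The joint family solves the parametric Robbin equation of its forcing family. [folklore] -/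
theorem forcedRobbinMap_skelJointCurve (m : ℕ) (r : WienerPair)
    (p : PhaseSpace N × PairSkeleton m) :
    forcedRobbinMap ((pinnedChain ω₂ lam β γ).drift N) (skelJointForcing ω₂ lam β γ N T_L T_R m r)
      (p, skelJointCurve hω hl hβ hγ N T_L T_R m r p) = 0 :=
  forcedRobbinMap_pinnedChainSolCurve hω hl hβ hγ N p.1 _ _ p.2

/-- … and is its unique solution. [folklore] -/
theorem eq_skelJointCurve_of_forcedRobbinMap_eq_zero (m : ℕ) (r : WienerPair)
    (p : PhaseSpace N × PairSkeleton m) (α : C(I, PhaseSpace N))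
    (h : forcedRobbinMap ((pinnedChain ω₂ lam β γ).drift N)
      (skelJointForcing ω₂ lam β γ N T_L T_R m r) (p, α) = 0) :
    α = skelJointCurve hω hl hβ hγ N T_L T_R m r p :=
  eq_pinnedChainSolCurve_of_forcedRobbinMap_eq_zero hω hl hβ hγ N p.1 _ _ p.2 α h

/-- **The joint family is `C^∞`** (R `contDiff_pinnedChainSolCurve_uncurry`). [folklore] -/
theorem contDiff_skelJointCurve (m : ℕ) (r : WienerPair) :
    ContDiff ℝ ∞ (skelJointCurve hω hl hβ hγ N T_L T_R m r) :=
  contDiff_pinnedChainSolCurve_uncurry hω hl hβ hγ N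
    (continuous_chainNoise_rem ω₂ lam β γ N T_L T_R r)
    (skelForcing N m (ampL ω₂ lam β γ T_L) (ampR ω₂ lam β γ T_R))

/-! ## 2. The dictionary: partial derivatives of the flow = derivatives of the joint family -/

/-- `D_x X_s^{m}(z, r, ·)(x)[δ] = D S'(z, x)[(0, δ)](s)`. [folklore] -/
theorem fderiv_skelFlowMapAt_eq_fderiv_joint {s : ℝ} (hs : s ∈ Icc (0 : ℝ) 1) (m : ℕ)
    (z : PhaseSpace N) (r : WienerPair) (x δ : PairSkeleton m) :
    fderiv ℝ (skelFlowMapAt ω₂ lam β γ N T_L T_R s m z r) x δ =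
      fderiv ℝ (skelJointCurve hω hl hβ hγ N T_L T_R m r) (z, x) ((0 : PhaseSpace N), δ)
        ⟨s, hs⟩ := by
  have hd : DifferentiableAt ℝ (skelJointCurve hω hl hβ hγ N T_L T_R m r) (z, x) :=
    ((contDiff_skelJointCurve hω hl hβ hγ N T_L T_R m r).differentiable (by simp)) _
  have h1 : HasFDerivAt (fun y : PairSkeleton m => skelJointCurve hω hl hβ hγ N T_L T_R m r (z, y))
      ((fderiv ℝ (skelJointCurve hω hl hβ hγ N T_L T_R m r) (z, x)).comp
        (ContinuousLinearMap.inr ℝ (PhaseSpace N) (PairSkeleton m))) x := by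
    have h := hd.hasFDerivAt.comp x (hasFDerivAt_prodMk_right (𝕜 := ℝ) z x)
    exact h
  have h2 := ((ContinuousMap.evalCLM ℝ (⟨s, hs⟩ : I) (M := PhaseSpace N)).hasFDerivAt.comp x
    h1).fderiv
  show fderiv ℝ (⇑(ContinuousMap.evalCLM ℝ (⟨s, hs⟩ : I) (M := PhaseSpace N)) ∘
      fun y : PairSkeleton m => skelJointCurve hω hl hβ hγ N T_L T_R m r (z, y)) x δ = _
  rw [h2]
  rfl

/-- `D_z X_s^{m}(·, r, x)(z)[v] = D S'(z, x)[(v, 0)](s)`. [folklore] -/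
theorem fderiv_skelFlowMapAt_left_eq_fderiv_joint {s : ℝ} (hs : s ∈ Icc (0 : ℝ) 1) (m : ℕ)
    (z : PhaseSpace N) (r : WienerPair) (x : PairSkeleton m) (v : PhaseSpace N) :
    fderiv ℝ (fun z' => skelFlowMapAt ω₂ lam β γ N T_L T_R s m z' r x) z v =
      fderiv ℝ (skelJointCurve hω hl hβ hγ N T_L T_R m r) (z, x) (v, (0 : PairSkeleton m))
        ⟨s, hs⟩ := by
  have hd : DifferentiableAt ℝ (skelJointCurve hω hl hβ hγ N T_L T_R m r) (z, x) :=
    ((contDiff_skelJointCurve hω hl hβ hγ N T_L T_R m r).differentiable (by simp)) _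
  have h1 : HasFDerivAt (fun z' : PhaseSpace N => skelJointCurve hω hl hβ hγ N T_L T_R m r (z', x))
      ((fderiv ℝ (skelJointCurve hω hl hβ hγ N T_L T_R m r) (z, x)).comp
        (ContinuousLinearMap.inl ℝ (PhaseSpace N) (PairSkeleton m))) z := by
    have h := hd.hasFDerivAt.comp z (hasFDerivAt_prodMk_left (𝕜 := ℝ) z x)
    exact h
  have h2 := ((ContinuousMap.evalCLM ℝ (⟨s, hs⟩ : I) (M := PhaseSpace N)).hasFDerivAt.comp z
    h1).fderiv
  show fderiv ℝ (⇑(ContinuousMap.evalCLM ℝ (⟨s, hs⟩ : I) (M := PhaseSpace N)) ∘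
      fun z' : PhaseSpace N => skelJointCurve hω hl hβ hγ N T_L T_R m r (z', x)) z v = _
  rw [h2]
  rfl

/-- **The mixed second variation is the evaluation of `D² S'[(0, δ)][(v, 0)]`.** [folklore] -/
theorem fderiv_fderiv_skelFlowMapAt_mixed_eq {s : ℝ} (hs : s ∈ Icc (0 : ℝ) 1) (m : ℕ)
    (z : PhaseSpace N) (r : WienerPair) (x : PairSkeleton m) (v : PhaseSpace N)
    (δ : PairSkeleton m) :
    fderiv ℝ (fun y => fderiv ℝ (fun z' => skelFlowMapAt ω₂ lam β γ N T_L T_R s m z' r y) z v) x δ =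
      fderiv ℝ (fderiv ℝ (skelJointCurve hω hl hβ hγ N T_L T_R m r)) (z, x)
        ((0 : PhaseSpace N), δ) (v, (0 : PairSkeleton m)) ⟨s, hs⟩ := by
  set S' := skelJointCurve hω hl hβ hγ N T_L T_R m r with hS'
  have hSd : ContDiff ℝ ∞ S' := contDiff_skelJointCurve hω hl hβ hγ N T_L T_R m r
  have hSd2 : ContDiff ℝ ((1 : ℕ∞) + 1 : ℕ∞) S' := hSd.of_le (by exact_mod_cast le_top)
  -- the evaluated family and the outer map
  have hEv : ContDiff ℝ ∞ fun p' : PhaseSpace N × PairSkeleton m => S' p' ⟨s, hs⟩ :=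
    (ContinuousMap.evalCLM ℝ (⟨s, hs⟩ : I) (M := PhaseSpace N)).contDiff.comp hSd
  set F : PhaseSpace N × PairSkeleton m → PhaseSpace N :=
    fun p => fderiv ℝ (fun p' => S' p' ⟨s, hs⟩) p (v, (0 : PairSkeleton m)) with hF
  -- the inner derivative, through the joint family, is `F (z, ·)`
  have hinner : (fun y => fderiv ℝ (fun z' => skelFlowMapAt ω₂ lam β γ N T_L T_R s m z' r y) z v) =
      F ∘ fun y : PairSkeleton m => (z, y) := by
    funext y
    rw [fderiv_skelFlowMapAt_left_eq_fderiv_joint hω hl hβ hγ N T_L T_R hs m z r y v]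
    have hE := ((ContinuousMap.evalCLM ℝ (⟨s, hs⟩ : I) (M := PhaseSpace N)).hasFDerivAt.comp
      (z, y) ((hSd.differentiable (by simp)) (z, y)).hasFDerivAt).fderiv
    show _ = fderiv ℝ (⇑(ContinuousMap.evalCLM ℝ (⟨s, hs⟩ : I) (M := PhaseSpace N)) ∘ S') (z, y)
      (v, (0 : PairSkeleton m))
    rw [hE]
    rfl
  have hFd : DifferentiableAt ℝ F (z, x) := by
    have h : ContDiff ℝ 1 F :=
      (hEv.fderiv_right (m := 1) ((two_le_withTop_add_one (le_refl (1 : ℕ∞))).trans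
        (WithTop.coe_le_coe.2 le_top))).clm_apply contDiff_const
    exact (h.differentiable one_ne_zero) _
  have h1 := (hFd.hasFDerivAt.comp x (hasFDerivAt_prodMk_right (𝕜 := ℝ) z x)).fderiv
  rw [hinner, h1]
  show fderiv ℝ F (z, x) ((0 : PhaseSpace N), δ) = _
  exact fderiv_fderiv_eval_apply hSd2 le_rfl (z, x) (v, (0 : PairSkeleton m))
    ((0 : PhaseSpace N), δ) ⟨s, hs⟩

/-! ## 3. The starting-point variation at every remainder and skeleton -/

include hω hl hβ hγ in
/-- **Pathwise Grönwall bound for the starting-point Jacobian of the skeleton flow**, for EVERY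
remainder `r`, skeleton `x`, direction `v` and `u ∈ [0, 1]`:
`‖D_z X_u^{m}(z, r, x)[v]‖ ≤ ‖v‖ · exp(∫₀ᵘ (A₀ + A₁ √H(X_t^{m}(z, r, x))) dt)` — first-variation
equation of the joint family (`fderiv_forcedSolution_family_apply`; the forcing derivative in the
direction `(v, 0)` is the constant curve `v`) + S′a's Grönwall. [folklore] -/
theorem norm_fderiv_skelFlowMapAt_left_le {u : ℝ} (hu : u ∈ Icc (0 : ℝ) 1) (m : ℕ)
    (z : PhaseSpace N) (r : WienerPair) (x : PairSkeleton m) (v : PhaseSpace N) :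
    ‖fderiv ℝ (fun z' => skelFlowMapAt ω₂ lam β γ N T_L T_R u m z' r x) z v‖ ≤
      ‖v‖ * Real.exp (∫ t in (0 : ℝ)..u, (driftA₀ ω₂ γ N + driftA₁ lam β N *
        √((pinnedChain ω₂ lam β γ).hamiltonian N
          (skelFlowMapAt ω₂ lam β γ N T_L T_R t m z r x)))) := by
  set S' := skelJointCurve hω hl hβ hγ N T_L T_R m r with hS'
  have hSd : ContDiff ℝ ∞ S' := contDiff_skelJointCurve hω hl hβ hγ N T_L T_R m r
  have hYtop := pinnedChain_contDiff_drift ω₂ lam β γ N (n := ⊤)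
  have hY'c : Continuous (fderiv ℝ ((pinnedChain ω₂ lam β γ).drift N)) :=
    hYtop.continuous_fderiv (by simp)
  -- the first-variation equation in the direction `(v, 0)`, integrand in closed form
  have hode : ∀ τ : I, fderiv ℝ S' (z, x) (v, (0 : PairSkeleton m)) τ = v +
      ∫ t in (0 : ℝ)..(τ : ℝ), fderiv ℝ ((pinnedChain ω₂ lam β γ).drift N)
        (IccExtend zero_le_one (S' (z, x)) t)
        (IccExtend zero_le_one (fderiv ℝ S' (z, x) (v, (0 : PairSkeleton m))) t) := by
    intro τ
    rw [fderiv_forcedSolution_family_apply (n := ⊤) (S := S') hYtop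
      (contDiff_skelJointForcing ω₂ lam β γ N T_L T_R m r) le_top
      (forcedRobbinMap_skelJointCurve hω hl hβ hγ N T_L T_R m r)
      (eq_skelJointCurve_of_forcedRobbinMap_eq_zero hω hl hβ hγ N T_L T_R m r) (z, x)
      (v, (0 : PairSkeleton m)) τ, fderiv_skelJointForcing, skelJointForcingDeriv_inl_apply]
    simp_rw [IccExtend_applyCLM_nemytskii_eq hY'c]
  set w : ℝ → PhaseSpace N :=
    IccExtend zero_le_one (fderiv ℝ S' (z, x) (v, (0 : PairSkeleton m))) with hw
  set Xc : ℝ → PhaseSpace N := IccExtend zero_le_one (S' (z, x)) with hXc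
  have hXu : ∀ t ∈ Icc (0 : ℝ) 1, Xc t = skelFlowMapAt ω₂ lam β γ N T_L T_R t m z r x := by
    intro t ht
    rw [hXc, IccExtend_of_mem zero_le_one _ ht]
    rfl
  have hXcont : Continuous fun t => skelFlowMapAt ω₂ lam β γ N T_L T_R t m z r x :=
    continuous_skelFlowMapAt_time hω hl hβ hγ N T_L T_R m z r x
  have hAc : Continuous fun t => fderiv ℝ ((pinnedChain ω₂ lam β γ).drift N)
      (skelFlowMapAt ω₂ lam β γ N T_L T_R t m z r x) := hY'c.comp hXcont
  have hHc := pinnedChain_continuous_hamiltonian ω₂ lam β γ N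
  have hac : Continuous fun t => driftA₀ ω₂ γ N + driftA₁ lam β N *
      √((pinnedChain ω₂ lam β γ).hamiltonian N
        (skelFlowMapAt ω₂ lam β γ N T_L T_R t m z r x)) :=
    continuous_const.add (continuous_const.mul ((hHc.comp hXcont).sqrt))
  have hAa : ∀ t v', ‖(fderiv ℝ ((pinnedChain ω₂ lam β γ).drift N)
      (skelFlowMapAt ω₂ lam β γ N T_L T_R t m z r x)) v'‖ ≤
      (driftA₀ ω₂ γ N + driftA₁ lam β N * √((pinnedChain ω₂ lam β γ).hamiltonian N
        (skelFlowMapAt ω₂ lam β γ N T_L T_R t m z r x))) * ‖v'‖ :=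
    fun t v' => norm_fderiv_drift_apply_le hω hl hβ hγ N _ v'
  have ha0 : ∀ t, 0 ≤ driftA₀ ω₂ γ N + driftA₁ lam β N *
      √((pinnedChain ω₂ lam β γ).hamiltonian N
        (skelFlowMapAt ω₂ lam β γ N T_L T_R t m z r x)) :=
    fun t => add_nonneg (driftA₀_nonneg hω.le hγ N)
      (mul_nonneg (driftA₁_nonneg lam β N) (Real.sqrt_nonneg _))
  have hw_c : Continuous w := continuous_IccExtend_coe _
  have hXc_c : Continuous Xc := continuous_IccExtend_coe _
  have hAclc : Continuous fun t => fderiv ℝ ((pinnedChain ω₂ lam β γ).drift N) (Xc t) (w t) :=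
    (hY'c.comp hXc_c).clm_apply hw_c
  -- the integral equation of `w` on `[0, 1]`, linear part unclamped
  have heq : ∀ t ∈ Icc (0 : ℝ) 1, w t = v +
      ∫ t' in (0 : ℝ)..t, (fderiv ℝ ((pinnedChain ω₂ lam β γ).drift N)
        (skelFlowMapAt ω₂ lam β γ N T_L T_R t' m z r x)) (w t') := by
    intro t ht
    have h1 : w t = fderiv ℝ S' (z, x) (v, (0 : PairSkeleton m)) ⟨t, ht⟩ :=
      IccExtend_of_mem zero_le_one _ ht
    rw [h1, hode ⟨t, ht⟩]
    have hcoe : ((⟨t, ht⟩ : I) : ℝ) = t := rfl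
    rw [hcoe]
    congr 1
    refine intervalIntegral.integral_congr fun t' ht' => ?_
    have ht'1 : t' ∈ Icc (0 : ℝ) 1 := by
      rw [uIcc_of_le ht.1] at ht'
      exact ⟨ht'.1, ht'.2.trans ht.2⟩
    simp only [hXu t' ht'1]
  have hmain := norm_le_mul_exp_integral_of_eq_add_integral (T := 1) hw_c hAc hac hAa ha0 heq hu
  have hwu : w u = fderiv ℝ S' (z, x) (v, (0 : PairSkeleton m)) ⟨u, hu⟩ :=
    IccExtend_of_mem zero_le_one _ hu
  rw [fderiv_skelFlowMapAt_left_eq_fderiv_joint hω hl hβ hγ N T_L T_R hu m z r x v, ← hwu]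
  exact hmain

end Joint

end Summit.AtomisticToContinuum.FouriersLaw.Theorems.ExtensiveSnapshotIrreversibility.EnergyWindow

end
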